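import Summits.Schanuel.Schanuel.Theses.DiophantineDichotomy
import Literature.NumberTheory.Transcendental.QuadraticRelationsLogarithmsWeilHeight

/-!
Sketch for crux-ideate stmt-Schanuel-6118 (EPiSimultaneousType), round 2, ideator k = 5,
card `ap2-liouville-descent`.  Only STATEMENTS (Props) + two pure-logic sanity proofs — no
skeleton.

LEVER (the race run in reverse, then Liouville at ONE point).  Philippon's approximation
property AP2 in `ℙ²` (a printed THEOREM: LNM 1752 Ch. 4 §4 p. 50 = PDF p. 61, "for n = 1, 2 the
following assertion is also proved"; Philippon, JNT 81 (2000) doi:10.1006/jnth.1999.2461) supplies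
at EVERY scale `(Δ, Y)` an algebraic point `α` of `ℂ²` near `θ = (π, e)` with
`[ℚ(α):ℚ] ≤ (cΔ)²`, `[ℚ(α):ℚ]·h(α) ≤ c²YΔ`, `‖α − θ‖ ≤ exp(−[ℚ(α):ℚ](h(α)Δ + Y)/c)`.
(1) The crux, read as an UPPER bound on the quality of `α`, forces `[ℚ(α):ℚ] ≥ (Δ/2cC)^{1/a}`
    (`RaceReverse` — the kernel of Disproof.lean's `race`, at `t = 2`, where `a ≥ 1/2` makes the
    two statements compatible and the information comes out as a DEGREE LOWER BOUND).
(2) Given a non-zero `P ∈ ℤ[x, y]` (degree `δ`, log-height `h`) with `|P(θ)| = e^{−λ}`, take the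
    AP2 point at scale `(Δ, Δ^q)`.  If `P(α) ≠ 0`, Liouville at the single point `α` (cost
    `[ℚ(α):ℚ](h + 2δh(α)) ≤ c²Δ²h + 2δc²Δ^{q+1}`) and proximity give `λ ≤ B(Δ)`; if `P(α) = 0`
    then `|P(θ)| ≤ ‖∇P‖·‖α − θ‖` gives `λ ≥ L(Δ) ≍ Δ^{q+1/a}`.  Since `1/a > 1`, `L ≫ B`: at the
    first scale with `L(Δ) > λ` the first case must hold, whence
    `λ ≤ C_q (h + δ + 1)^{1+2/(q+1/a−2)} (δ+1)^{max(q+2,(aq+1)/(1−a))}` for every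
    `q ≥ max(2, (b−1)/a)`.
So the crux IMPLIES a measure of algebraic independence of `(π, e)` (finite transcendence type),
and `EPiSimultaneousType → AP2 → e ⊥ π` with no level-1 (Laurent–Roy) input.
-/

set_option linter.dupNamespace false

namespace Summit.Schanuel.Schanuel.Cruxes.EPiSimultaneousType.AP2Descent

open Summit.Schanuel.Schanuel.Theses.DiophantineDichotomy
open Literature.NumberTheory.Transcendental
open MvPolynomial

noncomputable section

/-- θ = (π, e), as in the route file. -/
def theta : Fin 2 → ℂ := ![(Real.pi : ℂ), (Real.exp 1 : ℂ)]

/-- The admissibility clause of the crux for `(d, H, γ)` (verbatim from the crux). -/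
def Admissible (d H : ℕ) (γ : Fin 2 → ℂ) : Prop :=
  Module.finrank ℚ ↥(IntermediateField.adjoin ℚ (Set.range γ)) ≤ d ∧
    ∀ i, ∃ P : Polynomial ℤ, P ≠ 0 ∧ P.natDegree ≤ d ∧ (∀ k, |P.coeff k| ≤ (H : ℤ)) ∧
      Polynomial.aeval (γ i) P = 0

/-- A simultaneous approximation measure of the crux's shape at `ϑ` (Disproof.lean `MeasureAt`). -/
def MeasureAt (ϑ : Fin 2 → ℂ) (a b C : ℝ) : Prop :=
  ∀ (d H : ℕ) (γ : Fin 2 → ℂ), Admissible d H γ →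
    Real.exp (-(C * ((d : ℝ) ^ a * Real.log H + (d : ℝ) ^ b))) ≤ ‖γ - ϑ‖

/-- READ-BACK: the crux is `∃ a < 1, b, C > 0, MeasureAt θ a b C`. [folklore] -/
theorem crux_iff : EPiSimultaneousType ↔ ∃ a b C : ℝ, a < 1 ∧ 0 < C ∧ MeasureAt theta a b C := by
  simp only [EPiSimultaneousType, MeasureAt, Admissible, theta, and_imp]

/-- The number field of an algebraic point `α ∈ ℂ²`. -/
def fieldOf (α : Fin 2 → ℂ) : IntermediateField ℚ ℂ := IntermediateField.adjoin ℚ (Set.range α)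

/-- Its degree `[ℚ(α):ℚ]` (as a real number). -/
def degOf (α : Fin 2 → ℂ) : ℝ := (Module.finrank ℚ ↥(fieldOf α) : ℝ)

/-- "`α` is an AP2 approximant of θ at scale `(Δ, Y)` with constant `c`": algebraic coordinates,
`[ℚ(α):ℚ] ≤ (cΔ)²`, `[ℚ(α):ℚ]·h(1:α₁:α₂) ≤ c²·Y·Δ` (projective absolute Weil height of the POINT,
tree decl `weilHeight₁`), and `‖α − θ‖ ≤ exp(−[ℚ(α):ℚ]·(h(α)·Δ + Y)/c)`.  This is the `n = 2`
case of Philippon's APPROXIMATION PROPERTY 2 at `x = (1 : π : e)` in the affine chart (sup-norm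
distance instead of `Dist`, constant moved to the denominator — both only weaken it). -/
def IsAP2Point (c Δ Y : ℝ) (α : Fin 2 → ℂ) : Prop :=
  (∀ i, IsAlgebraic ℚ (α i)) ∧ degOf α ≤ (c * Δ) ^ 2 ∧
    degOf α * weilHeight₁ (fieldOf α) α ≤ c ^ 2 * Y * Δ ∧
    ‖α - theta‖ ≤ Real.exp (-(degOf α * (weilHeight₁ (fieldOf α) α * Δ + Y) / c))

/-- **Philippon's AP2 at θ = (π, e)** (PRINTED THEOREM, LNM 1752 Ch. 4 §4 / Philippon 2000; to be
vendored as a Literature named fact and specialised): for some `c ≥ 1` and all `Δ ≥ c`,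
`Y ≥ cΔ` (which contains the printed side condition `H ≥ c' log(Δ+1)` since `Δ ≥ log(Δ+1)`) an
AP2 approximant exists.  (`trdeg ℚ(π, e) ≤ 2` is automatic, so no hypothesis on θ.) -/
def AP2At : Prop :=
  ∃ c : ℝ, 1 ≤ c ∧ ∀ Δ Y : ℝ, c ≤ Δ → c * Δ ≤ Y → ∃ α : Fin 2 → ℂ, IsAP2Point c Δ Y α

/-- FIRST LEMMA (the race in reverse; provable now, M-sized: the crux unfolded at the admissible
datum `(d, H) = ([ℚ(α):ℚ], naive height ≤ 2^d·exp(d·h(α)))` of `α` — the characteristic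
polynomials of the coordinates — plus real arithmetic).  A crux-shaped measure with exponents
`(a, b)`, `0 < a`, `1 < b`, forces every AP2 approximant at scale `(Δ, Y)`, `Y ≥ Δ ≥ Δ₀`, to
have LARGE degree: `[ℚ(α):ℚ] ≥ min((Δ/(4cC))^{1/a}, (Y/(4cC))^{1/(b−1)})`. -/
def RaceReverse : Prop :=
  ∀ (a b C c : ℝ), 0 < a → a < 1 → 1 < b → 0 < C → 1 ≤ c → MeasureAt theta a b C →
    ∃ Δ₀ : ℝ, ∀ (Δ Y : ℝ) (α : Fin 2 → ℂ), Δ₀ ≤ Δ → Δ ≤ Y → IsAP2Point c Δ Y α →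
      min ((Δ / (4 * c * C)) ^ (1 / a)) ((Y / (4 * c * C)) ^ (1 / (b - 1))) ≤ degOf α

/-- A measure of algebraic independence of `(π, e)` of FINITE TYPE: degree exponent `E₂`,
size exponent `E₁` (`E₁ = 1` would be "linear in the log-height"; the descent gives every
`E₁ > 1`): `|Q(π,e)| ≥ exp(−C (log Hq + deg Q + 1)^{E₁} (deg Q + 1)^{E₂})` for all non-zero
`Q ∈ ℤ[x, y]` with coefficients bounded by `Hq ≥ 2`. -/
def PolyPairType (E₁ E₂ C : ℝ) : Prop :=
  ∀ (Q : MvPolynomial (Fin 2) ℤ) (Hq : ℕ), Q ≠ 0 → 2 ≤ Hq → (∀ m, |Q.coeff m| ≤ (Hq : ℤ)) →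
    Real.exp (-(C * ((Real.log Hq + Q.totalDegree + 1) ^ E₁ * ((Q.totalDegree : ℝ) + 1) ^ E₂)))
      ≤ ‖aeval theta Q‖

/-- THE DESCENT (second statement; provable now modulo vendoring AP2, L-sized: `RaceReverse` +
Liouville's inequality for `Q(α) ∈ ℚ(α)` (tree: `Roy2013.orbit_liouville`,
`AlgGens.one_le_norm_mul_house_pow`) + mean-value proximity + the scale choice `Y = Δ^q`,
`q ≥ max(2, (b−1)/a)`): the crux and AP2 give `(π, e)` finite transcendence type, with
`E₁ = 1 + 2/(q + 1/a − 2)`, `E₂ = max(q + 2, (aq + 1)/(1 − a))` for ANY `q ≥ max(2, (b−1)/a)`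
(e.g. `(a,b) = (1/2, 1)`: `q = 2` gives `(E₁, E₂) = (2, 4)`, `q = 6` gives `(4/3, 8)`). -/
def AP2Descent : Prop :=
  AP2At → EPiSimultaneousType → ∃ E₁ E₂ C : ℝ, 1 < E₁ ∧ 0 < C ∧ PolyPairType E₁ E₂ C

/-- Explicit-exponent form of the descent (what the prover actually proves). -/
def AP2DescentExplicit : Prop :=
  AP2At → RaceReverse → ∀ (a b C q : ℝ), 1 / 2 ≤ a → a < 1 → 1 < b → 0 < C →
    max 2 ((b - 1) / a) ≤ q → MeasureAt theta a b C →
      ∃ C' : ℝ, 0 < C' ∧ PolyPairType (1 + 2 / (q + 1 / a - 2)) (max (q + 2) ((a * q + 1) / (1 - a))) C'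

/-- COROLLARY: an `EPiRace` WITHOUT the level-1 property — the crux plus the PRINTED level-2
property already give `e ⊥ π` (a finite-type measure kills every putative relation). -/
def EPiRaceViaAP2 : Prop :=
  AP2At → EPiSimultaneousType → AlgebraicIndependent ℚ ![Real.exp 1, Real.pi]

/-- `PolyPairType ⇒ e ⊥ π` is the only algebra `EPiRaceViaAP2` needs beyond `AP2Descent`
(sanity check of the shapes; the `MvPolynomial ℚ → ℤ` denominator clearing is left to the prover,
so we record the implication with an integer-polynomial formulation of dependence). -/
theorem no_integer_relation_of_polyPairType {E₁ E₂ C : ℝ} (h : PolyPairType E₁ E₂ C)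
    (Q : MvPolynomial (Fin 2) ℤ) (hQ : Q ≠ 0) : aeval theta Q ≠ 0 := by
  intro h0
  -- coefficients are bounded by some Hq ≥ 2
  obtain ⟨Hq, hHq2, hcoeff⟩ : ∃ Hq : ℕ, 2 ≤ Hq ∧ ∀ m, |Q.coeff m| ≤ (Hq : ℤ) := by
    refine ⟨(Q.support.sup fun m => (Q.coeff m).natAbs) + 2, by omega, fun m => ?_⟩
    by_cases hm : m ∈ Q.support
    · have h1 : (Q.coeff m).natAbs ≤ Q.support.sup fun m => (Q.coeff m).natAbs :=
        Finset.le_sup (f := fun m => (Q.coeff m).natAbs) hm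
      have h2 : |Q.coeff m| = ((Q.coeff m).natAbs : ℤ) := (Int.natCast_natAbs _).symm
      rw [h2]; push_cast; omega
    · rw [MvPolynomial.notMem_support_iff.mp hm]; simp
      positivity
  have := h Q Hq hQ hHq2 hcoeff
  rw [h0, norm_zero] at this
  exact absurd this (not_le.mpr (Real.exp_pos _))

/-- KILL-ROUTE SHAPE for the standing disprover (contrapositive of `AP2Descent`, AP2 being a
theorem): integer polynomials that are small at `(π, e)` beyond EVERY finite type refute the crux.
Not expected (generic truth `|Q| ≈ exp(−(deg Q)²/2·log Hq)`), but this is the PSLQ/LLL-searchable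
currency, unlike common-field pair approximants. -/
def SmallValueKill : Prop :=
  (∀ E : ℝ, ∃ (Q : MvPolynomial (Fin 2) ℤ) (Hq : ℕ), Q ≠ 0 ∧ 2 ≤ Hq ∧ (∀ m, |Q.coeff m| ≤ (Hq : ℤ)) ∧
      ‖aeval theta Q‖ < Real.exp (-(E * ((Real.log Hq + Q.totalDegree + 1) ^ E *
        ((Q.totalDegree : ℝ) + 1) ^ E)))) →
    AP2At → AP2Descent → ¬ EPiSimultaneousType

/-- `SmallValueKill` is pure logic given the descent. -/
theorem smallValueKill_holds : SmallValueKill := by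
  intro hsmall hAP hdesc hcrux
  obtain ⟨E₁, E₂, C, -, hC, hmeas⟩ := hdesc hAP hcrux
  set m : ℝ := max 1 (max E₁ (max E₂ C)) with hm
  obtain ⟨Q, Hq, hQ0, hHq, hcoeff, hlt⟩ := hsmall m
  have hle := hmeas Q Hq hQ0 hHq hcoeff
  have hlog : 0 ≤ Real.log Hq := Real.log_natCast_nonneg Hq
  have hdeg : (0 : ℝ) ≤ (Q.totalDegree : ℝ) := by positivity
  have hS1 : (1 : ℝ) ≤ Real.log Hq + Q.totalDegree + 1 := by linarith
  have hD1 : (1 : ℝ) ≤ (Q.totalDegree : ℝ) + 1 := by linarith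
  have h1m : (1 : ℝ) ≤ m := le_max_left _ _
  have hE1m : E₁ ≤ m := le_trans (le_max_left _ _) (le_max_right _ _)
  have hE2m : E₂ ≤ m := le_trans (le_trans (le_max_left _ _) (le_max_right _ _)) (le_max_right _ _)
  have hCm : C ≤ m := le_trans (le_trans (le_max_right _ _) (le_max_right _ _)) (le_max_right _ _)
  have hA : (Real.log Hq + Q.totalDegree + 1) ^ E₁ ≤ (Real.log Hq + Q.totalDegree + 1) ^ m :=
    Real.rpow_le_rpow_of_exponent_le hS1 hE1m
  have hB : ((Q.totalDegree : ℝ) + 1) ^ E₂ ≤ ((Q.totalDegree : ℝ) + 1) ^ m :=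
    Real.rpow_le_rpow_of_exponent_le hD1 hE2m
  have hApos : 0 ≤ (Real.log Hq + Q.totalDegree + 1) ^ E₁ := by positivity
  have hBpos : 0 ≤ ((Q.totalDegree : ℝ) + 1) ^ m := by positivity
  have key : C * ((Real.log Hq + Q.totalDegree + 1) ^ E₁ * ((Q.totalDegree : ℝ) + 1) ^ E₂)
      ≤ m * ((Real.log Hq + Q.totalDegree + 1) ^ m * ((Q.totalDegree : ℝ) + 1) ^ m) := by
    have hCpos : 0 ≤ C := hC.le
    calc C * ((Real.log Hq + Q.totalDegree + 1) ^ E₁ * ((Q.totalDegree : ℝ) + 1) ^ E₂)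
        ≤ C * ((Real.log Hq + Q.totalDegree + 1) ^ E₁ * ((Q.totalDegree : ℝ) + 1) ^ m) := by
          gcongr
      _ ≤ C * ((Real.log Hq + Q.totalDegree + 1) ^ m * ((Q.totalDegree : ℝ) + 1) ^ m) := by
          gcongr
      _ ≤ m * ((Real.log Hq + Q.totalDegree + 1) ^ m * ((Q.totalDegree : ℝ) + 1) ^ m) := by
          gcongr
  have hexp : Real.exp (-(m * ((Real.log Hq + Q.totalDegree + 1) ^ m * ((Q.totalDegree : ℝ) + 1) ^ m)))
      ≤ Real.exp (-(C * ((Real.log Hq + Q.totalDegree + 1) ^ E₁ * ((Q.totalDegree : ℝ) + 1) ^ E₂))) := by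
    rw [Real.exp_le_exp]; linarith
  linarith [lt_of_le_of_lt (le_trans hexp hle) hlt]

end

end Summit.Schanuel.Schanuel.Cruxes.EPiSimultaneousType.AP2Descent
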